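import Mathlib
import Literature.Computability.Complexity.Space
import Literature.Computability.Complexity.TrivialLanguagesSpace
import HarnessLib

/-!
# Description-length–charged per-length space classes `DSPACE(t)/ₙ a` (Hirahara, ToC 2023,
# Def. 4.7), rendered intrinsically for bounded-hardware multi-stack space machines

Census definition request **D13** (pub-magnif, referee r19 / F34). Source: S. Hirahara,
*Non-disjoint promise problems from meta-computational view of pseudorandom generator
constructions*, Theory of Computing 19(4) (2023) [bib: Hirahara2023NonDisjoint; held text
`paper:doi-10-4086-toc-2023-v019a004`], §4.2 [p. 33 L20–24]: *"Definition 4.7 (Length-wise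
advice). For any integers t, a, n ∈ ℕ, we denote by DTIME(t)/ₙ a the class of functions
f : {0,1}ⁿ → {0,1} such that there exists a Turing machine M whose description length¹² is a
and that outputs f(x) on input x ∈ {0,1}ⁿ in time t. Similarly, let DSPACE(t)/ₙ a denote the class
of functions f : {0,1}ⁿ → {0,1} such that there exists a Turing machine M whose description
length is a and that outputs f(x) on input x ∈ {0,1}ⁿ in space t."*, with footnote 12
[p. 33 L40–41]: *"The description length |d_M| of a machine M can be formally defined by using a
universal Turing machine U. Specifically, a description d_M ∈ {0,1}* of M is a string that
satisfies U(d_M, x) = M(x) for every x."* First consumer: the YES side `DSPACE(cn)/ₙ cn` of the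
non-disjoint promise problem of Thm. 1.13 (census row R28; `Hirahara2020/ReadOnceBranchingPrograms
.lean` had to shrink it to junta-sized deterministic branching programs, referee finding F34).

## Rendering (what is typed, and in which direction it relates to print)

The tree's space machines are `SpaceMachine Bool Bool` (`Complexity/Space.lean`: Mathlib
`Turing.FinTM2` multi-stack machines with a two-stack read-only input, charged work space
`workSpace`, `IsInputPreserving`, `HaltsWith`, `RunsInSpace`). Print measures the description
length of `M` relative to a universal machine `U`; the tree has no space-charged universal
machine, so the description length is rendered INTRINSICALLY and only for machines with BOUNDED
HARDWARE (`HasBoundedHardware`: at most 8 stacks, every stack alphabet of at most 4 symbols, at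
most 8 internal-memory values — constants chosen to admit the tree's existing machines, e.g.
`ConstAnswer.machine`): `descLen M := progNodes M · (⌊log₂ |Λ|⌋ + 1)`, where `progNodes M` is the
total number of nodes of the statement trees `M.tm.m q` over all labels `q : Λ` (`stmtNodes`).
This is, up to a universal constant factor `C₀`, an UPPER BOUND on the bit length of the evident
prefix-free binary encoding of such a machine (statement trees in prefix order — node kind, stack
index, the finite function tables of a node have at most `8 · 5` entries of at most 3 bits, a
`goto` table has at most 8 label indices of `⌊log₂ |Λ|⌋ + 1` bits each; the header — main label,
initial memory value, the roles `k₀, k₁, kL`, the alphabet identifications — is dominated since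
`|Λ| ≤ progNodes M`, every label owning at least one node, `stmtNodes_pos`).

`DSPACEdl t a n` := the functions `f : {0,1}ⁿ → {0,1}` computed, on every `x ∈ {0,1}ⁿ` (input
`List.ofFn x`, output `encodeBool (f x)` on the output stack at the halting configuration, input
preserved, work space `≤ t` throughout), by some bounded-hardware machine with `descLen ≤ a`
(`SpaceMachine.ComputesFnInSpace`).

DIRECTION (informal, standard; recorded for the census direction ledger, NOT typed): fix a
universal machine `U₀` that decodes the above format and simulates bounded-hardware stack
machines step by step (each stack cell costs ≤ 2 bits on a binary work tape, the read-only input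
stacks are `U₀`'s input head, the current label and program position cost `O(log a)` bits). Then
every `f ∈ DSPACEdl t a n` has a `U₀`-description of length `≤ C₀·a + C₀` from which `U₀` outputs
`f(x)` in space `≤ C₀·(t + log a) + C₀`; by the invariance theorem the same holds for any universal
`U` with another additive constant. Consequently `DSPACEdl (c·n) (c·n) n ⊆ DSPACE(c'·n)/ₙ (c'·n)`
for a constant `c'` depending only on `c` (and `U`): the rendered class at index `c` is a SUB-class
of print's class at index `c'`. Theorems of print hypothesising over `DSPACE(cn)/ₙ cn` for
ARBITRARY `c` (Thm. 1.13, p. 45 L7 *"Given arbitrary constants c, α, β > 0"*) therefore cover the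
rendered classes after re-indexing — the admissible (weaker-or-equal) direction for R28. The
converse containment (print's machines may have more tapes / larger alphabets; simulable on bounded
hardware at constant cost) is not claimed.

PROVED here: `stmtNodes_pos`; monotonicity `DSPACEdl_mono`; **uniform-to-slice**
`mem_DSPACEdl_of_decidesInSpace` (a bounded-hardware machine deciding a language `L` in space `S`
puts the length-`n` slice of `L` into `DSPACEdl t a n` as soon as `a ≥ descLen M` and
`t ≥ S` on length-`n` inputs — so the slices of every such uniform `DSPACE` language are in the
class for all large `n` when `a = c·n`); the bounded hardware and `descLen = 2` of the tree's
constant-answer machines, whence **F1** `const_mem_DSPACEdl : (fun _ => b) ∈ DSPACEdl t a n` for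
`t ≥ 1`, `a ≥ 2`. NOT typed: `DTIME(t)/ₙ a`; Fact 4.8 (equivalence with Karp–Lipton advice);
a counting upper bound on `DSPACEdl` (informally `≤ 2^{C₀ a + C₀}` functions).
-/

namespace Literature.Computability.Complexity

open _root_.Computability Turing StateTransition

/-! ### Program size of a multi-stack machine -/

/-- Number of nodes of a `TM2` statement tree (every constructor counts one). [folklore] -/
def stmtNodes {K : Type} {Γ : K → Type} {Λ σ : Type} : TM2.Stmt Γ Λ σ → ℕ
  | .push _ _ q => stmtNodes q + 1
  | .peek _ _ q => stmtNodes q + 1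
  | .pop _ _ q => stmtNodes q + 1
  | .load _ q => stmtNodes q + 1
  | .branch _ q₁ q₂ => stmtNodes q₁ + stmtNodes q₂ + 1
  | .goto _ => 1
  | .halt => 1

/-- Every statement has at least one node. [folklore] -/
theorem stmtNodes_pos {K : Type} {Γ : K → Type} {Λ σ : Type} (q : TM2.Stmt Γ Λ σ) :
    0 < stmtNodes q := by
  cases q <;> simp [stmtNodes]

namespace SpaceMachine

variable {Γ₀ Γ₁ : Type}

/-- Total program size of a space machine: the number of statement nodes summed over all labels.
[folklore] -/
noncomputable def progNodes (M : SpaceMachine Γ₀ Γ₁) : ℕ :=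
  haveI := M.tm.ΛFin
  ∑ q : M.tm.Λ, stmtNodes (M.tm.m q)

/-- BOUNDED HARDWARE: at most 8 stacks, every stack alphabet finite with at most 4 symbols, at
most 8 internal-memory values (so a fixed universal machine simulates the machine with `O(1)`
space overhead per cell and each program node costs `O(log |Λ| + 1)` description bits; module
docstring). [cite: Hirahara2023NonDisjoint, Def. 4.7 footnote 12 (p. 33), rendering] -/
def HasBoundedHardware (M : SpaceMachine Γ₀ Γ₁) : Prop :=
  Nat.card M.tm.K ≤ 8 ∧ (∀ k, Finite (M.tm.Γ k) ∧ Nat.card (M.tm.Γ k) ≤ 4) ∧ Nat.card M.tm.σ ≤ 8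

/-- The rendered DESCRIPTION LENGTH of a space machine: program nodes times `⌊log₂ |Λ|⌋ + 1`
(bits per label reference) — an upper bound up to a universal constant factor on the length of a
prefix-free binary encoding of a bounded-hardware machine (module docstring).
[cite: Hirahara2023NonDisjoint, Def. 4.7 footnote 12 (p. 33), rendering] -/
noncomputable def descLen (M : SpaceMachine Γ₀ Γ₁) : ℕ :=
  M.progNodes * (Nat.log 2 (Nat.card M.tm.Λ) + 1)

/-- `M.ComputesFnInSpace n f t`: the Boolean space machine `M` is input preserving and, on every
`x ∈ {0,1}ⁿ` (as the list `List.ofFn x`), halts with output `encodeBool (f x)` using work space at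
most `t` throughout — the per-length, function form of `DecidesInSpace`.
[cite: Hirahara2023NonDisjoint, Def. 4.7 (p. 33: "outputs f(x) on input x ∈ {0,1}ⁿ in space t")] -/
def ComputesFnInSpace (M : SpaceMachine Bool Bool) (n : ℕ) (f : (Fin n → Bool) → Bool)
    (t : ℕ) : Prop :=
  M.IsInputPreserving ∧ ∀ x : Fin n → Bool,
    (∃ c, M.HaltsWith (List.ofFn x) (encodeBool (f x)) c) ∧ M.RunsInSpace (List.ofFn x) t

/-- Monotonicity of `ComputesFnInSpace` in the space bound. [folklore] -/
theorem ComputesFnInSpace.mono {M : SpaceMachine Bool Bool} {n : ℕ} {f : (Fin n → Bool) → Bool}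
    {t t' : ℕ} (h : M.ComputesFnInSpace n f t) (ht : t ≤ t') : M.ComputesFnInSpace n f t' :=
  ⟨h.1, fun x => ⟨(h.2 x).1, (h.2 x).2.mono ht⟩⟩

/-- **Uniform to slice**: a machine deciding the language `L` in space `S` computes, at every
length `n`, the slice `x ↦ [List.ofFn x ∈ L]` in space `t` whenever `S ≤ t` on length-`n` inputs.
[folklore] -/
theorem computesFnInSpace_of_decidesInSpace {M : SpaceMachine Bool Bool} {L : Language Bool}
    {S : List Bool → ℕ} (h : DecidesInSpace M L S) (n t : ℕ)
    (hS : ∀ x : List Bool, x.length = n → S x ≤ t) :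
    M.ComputesFnInSpace n (fun x => L.boolIndicator (List.ofFn x)) t :=
  ⟨h.1, fun x => ⟨(h.2 (List.ofFn x)).1,
    ((h.2 (List.ofFn x)).2).mono (hS _ (List.length_ofFn))⟩⟩

end SpaceMachine

/-! ### The class `DSPACE(t)/ₙ a`, rendered -/

/-- **`DSPACE(t)/ₙ a` (rendered)**: the functions `f : {0,1}ⁿ → {0,1}` computed within work space
`t` on all of `{0,1}ⁿ` by some BOUNDED-HARDWARE space machine of rendered description length
`≤ a`. A sub-class (after re-indexing constants) of print's `U`-relative class — module docstring,
DIRECTION. [cite: Hirahara2023NonDisjoint, Def. 4.7 (p. 33 L20–24)] -/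
def DSPACEdl (t a n : ℕ) : Set ((Fin n → Bool) → Bool) :=
  {f | ∃ M : SpaceMachine Bool Bool,
    M.HasBoundedHardware ∧ M.descLen ≤ a ∧ M.ComputesFnInSpace n f t}

/-- Monotonicity of `DSPACEdl` in the space bound and the description length. [folklore] -/
theorem DSPACEdl_mono {t t' a a' : ℕ} (ht : t ≤ t') (ha : a ≤ a') (n : ℕ) :
    DSPACEdl t a n ⊆ DSPACEdl t' a' n := by
  rintro f ⟨M, hM, hd, hc⟩
  exact ⟨M, hM, hd.trans ha, hc.mono ht⟩

/-- **Uniform to slice, class form**: if a bounded-hardware machine `M` decides `L` in space `S`,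
then the length-`n` slice of `L` lies in `DSPACEdl t a n` for every `a ≥ descLen M` and every `t`
dominating `S` on length-`n` inputs. In particular the slices of such a uniform `DSPACE(s)`
language are in `DSPACEdl (c·s n + c) (c·n) n` for all large `n`. [folklore] -/
theorem mem_DSPACEdl_of_decidesInSpace {M : SpaceMachine Bool Bool} {L : Language Bool}
    {S : List Bool → ℕ} (hM : M.HasBoundedHardware) (h : DecidesInSpace M L S) {n t a : ℕ}
    (hS : ∀ x : List Bool, x.length = n → S x ≤ t) (ha : M.descLen ≤ a) :
    (fun x : Fin n → Bool => L.boolIndicator (List.ofFn x)) ∈ DSPACEdl t a n :=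
  ⟨M, hM, ha, SpaceMachine.computesFnInSpace_of_decidesInSpace h n t hS⟩

/-! ### Non-vacuity (census rule F1): the constant functions, via the tree's constant-answer
machines (`TrivialLanguagesSpace.lean`) -/

namespace ConstAnswer

/-- The constant-answer machine has bounded hardware (3 stacks, Boolean alphabets, trivial
memory). [folklore] -/
theorem hasBoundedHardware (b : Bool) : (machine b).HasBoundedHardware := by
  refine ⟨?_, fun k => ⟨?_, ?_⟩, ?_⟩
  · show Nat.card K3 ≤ 8
    rw [Nat.card_eq_fintype_card]
    decide
  · show Finite Bool
    infer_instance
  · show Nat.card Bool ≤ 4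
    simp
  · show Nat.card Unit ≤ 8
    simp

/-- Its program has two nodes (`push out b; halt`). [folklore] -/
theorem progNodes_eq (b : Bool) : (machine b).progNodes = 2 := by
  show (∑ q : Unit, stmtNodes (prog b q)) = 2
  simp [prog, stmtNodes]

/-- Its rendered description length is `2` (one label: `⌊log₂ 1⌋ + 1 = 1` bit per reference).
[folklore] -/
theorem descLen_eq (b : Bool) : (machine b).descLen = 2 := by
  unfold SpaceMachine.descLen
  rw [progNodes_eq]
  show 2 * (Nat.log 2 (Nat.card Unit) + 1) = 2
  simp

/-- The constant-answer machine computes the constant function `b` on `{0,1}ⁿ` in work space `t`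
for every `t ≥ 1`. [folklore] -/
theorem computesFnInSpace (b : Bool) (n : ℕ) {t : ℕ} (ht : 1 ≤ t) :
    (machine b).ComputesFnInSpace n (fun _ => b) t := by
  -- the language whose indicator is constantly `b`
  have hL : ∀ x : List Bool, ({y : List Bool | b = true} : Language Bool).boolIndicator x = b := by
    intro x
    unfold Set.boolIndicator
    cases b <;> simp
  have hd := decidesInSpace b hL
  refine ⟨hd.1, fun x => ⟨?_, ((hd.2 (List.ofFn x)).2).mono ht⟩⟩
  have h1 := (hd.2 (List.ofFn x)).1
  rwa [hL] at h1

end ConstAnswer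

/-- **F1**: the constant functions lie in `DSPACEdl t a n` for all `t ≥ 1`, `a ≥ 2` (every `n`).
[folklore] -/
theorem const_mem_DSPACEdl (b : Bool) {t a : ℕ} (ht : 1 ≤ t) (ha : 2 ≤ a) (n : ℕ) :
    (fun _ : Fin n → Bool => b) ∈ DSPACEdl t a n :=
  ⟨ConstAnswer.machine b, ConstAnswer.hasBoundedHardware b,
    (ConstAnswer.descLen_eq b).le.trans ha, ConstAnswer.computesFnInSpace b n ht⟩

/-- Hence `DSPACEdl (c·n) (c·n) n` is nonempty as soon as `c·n ≥ 2`. [folklore] -/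
theorem DSPACEdl_linear_nonempty {c n : ℕ} (h : 2 ≤ c * n) : (DSPACEdl (c * n) (c * n) n).Nonempty :=
  ⟨fun _ => false, const_mem_DSPACEdl false (le_trans (by norm_num) h) h n⟩

end Literature.Computability.Complexity
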